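import Mathlib
import HarnessLib
import Summits.Parity.GeneralizedHardyLittlewood.Theses.LiouvilleShiftedTables
import Summits.Parity.GeneralizedHardyLittlewood.Theorems.DilatedTableChowla.Negative.DilatedTableChowlaBlocks

/-!
# Sketch (crux-ideate round 2, ideator 4) — crux `DilatedTableChowla` (stmt-Parity-14271)

First lemmas for the two idea cards of this seat:

* §1 card `dilated-symbol-normal-form`: every class block `(q;u,v)` of the shifted multiplication
  table is, after the column substitution `b = v + q j`, a ROW-SHIFTED multiplication table of the
  `q₁`-dilated Liouville symbol, `q₁ = q / gcd(q, uv+c)`; for ZERO classes (`q ∣ uv+c`, the only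
  classes the route's glue consumes) `q₁ = 1`, the row shifts `t_a = (av+c)/q` satisfy
  `q (a' t_a − a t_{a'}) = c (a' − a)` and the `2×2` block determinant is `k·c·(a'−a)/q = hkc`,
  exactly the sibling crux's determinant.  (N1)–(N4) are the kernel-checked identities; the
  Prop-level split `ZeroClassDilated` / `NonzeroClassDilated` is stated with the trivial
  directions proved.
* §2 card `cm-dichotomy-sections`: the statements of the line (inverse theorem for AP-indexed
  Helson sections, relative-error one-point data, thin-family Bombieri–Vinogradov, one-sided
  aperiodic residual) as `Prop`s over the landed block notation, so that triage can attack symbols.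
-/

namespace Summit.Parity.GeneralizedHardyLittlewood.Cruxes.DilatedTableChowla.SketchIdeator4

open Summit.Parity.GeneralizedHardyLittlewood.Theses.LiouvilleShiftedTables
open Summit.Parity.GeneralizedHardyLittlewood.Theorems.DilatedTableChowla.Negative
open Finset

/-! ## §1 `dilated-symbol-normal-form` -/

/-- (N1) Reindexing a block entry along the column class: if `q t = a v + c` then for the column
`b = v + q j` one has `a b + c = q (a j + t)`. -/
theorem entry_zero_class (a v c q j t : ℤ) (ht : q * t = a * v + c) :
    a * (v + q * j) + c = q * (a * j + t) := by
  linear_combination (-1 : ℤ) * ht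

/-- (N1') General class: with `g t = a v + c` (`g = gcd(q, uv+c)`, `q = g q₁`) the entry is
`g · (q₁ (a j) + t)`: a row-shifted table of the `q₁`-DILATED symbol `m ↦ λ(q₁ m + t)`. -/
theorem entry_general_class (a v c g q₁ j t : ℤ) (ht : g * t = a * v + c) :
    a * (v + g * q₁ * j) + c = g * (q₁ * (a * j) + t) := by
  linear_combination (-1 : ℤ) * ht

/-- (N2) The row shifts of a zero-class block are projectively affine: `q (a' t − a t') = c (a' − a)`.
On the van-der-Corput band `a' = a + q h` this is `a' t − a t' = h c`: BOUNDED aligned shifts. -/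
theorem rowShift_cross (a a' v c q t t' : ℤ) (ht : q * t = a * v + c) (ht' : q * t' = a' * v + c) :
    q * (a' * t - a * t') = c * (a' - a) := by
  linear_combination a' * ht - a * ht'

/-- (N3) `2×2` block determinant of a row-shifted multiplication table `(a j + s)`. -/
theorem rowShifted_block_det (a a' j k s s' : ℤ) :
    (a * j + s) * (a' * (j + k) + s') - (a' * j + s') * (a * (j + k) + s) = k * (a' * s - a * s') := by
  ring

/-- (N3') For a ZERO-class block the determinant is `k c (a'−a)/q`, i.e. `h k c` on the band
`a' = a + q h` — the SAME determinant as the undilated table (sibling line `corner-local-box`). -/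
theorem zeroClass_block_det (a a' v c q j k t t' : ℤ) (ht : q * t = a * v + c)
    (ht' : q * t' = a' * v + c) :
    q * ((a * j + t) * (a' * (j + k) + t') - (a' * j + t') * (a * (j + k) + t)) =
      k * c * (a' - a) := by
  linear_combination k * (a' * ht - a * ht')

/-- (N3'') band form: with `a' = a + q h`, the zero-class determinant is literally `h k c`. -/
theorem zeroClass_block_det_band (a v c q h j k t t' : ℤ) (hq : q ≠ 0) (ht : q * t = a * v + c)
    (ht' : q * t' = (a + q * h) * v + c) :
    (a * j + t) * ((a + q * h) * (j + k) + t') - ((a + q * h) * j + t') * (a * (j + k) + t) =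
      h * k * c := by
  have key := zeroClass_block_det a (a + q * h) v c q j k t t' ht ht'
  have : q * ((a * j + t) * ((a + q * h) * (j + k) + t') - ((a + q * h) * j + t') * (a * (j + k) + t))
      = q * (h * k * c) := by rw [key]; ring
  exact mul_left_cancel₀ hq this

/-- (N4) λ-level factorisation of a zero-class entry: `L (a b + c) = L q · L (a j + t)` for
`b = v + q j`, `q t = a v + c`, once `a j + t ≥ 0` (automatic in the window, `entries_pos`). -/
theorem L_entry_zero_class {a v c j t : ℤ} {q : ℕ} (ht : (q : ℤ) * t = a * v + c)
    (hpos : 0 ≤ a * j + t) :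
    L (a * (v + q * j) + c) = L q * L (a * j + t) := by
  rw [entry_zero_class a v c q j t ht]
  obtain ⟨n, hn⟩ := Int.eq_ofNat_of_zero_le hpos
  rw [hn, L_natCast_mul]

/-- (N4') hence the two-row products of a zero-class block do not see `q` at all:
`L(ab+c) L(a'b+c) = L(aj+t) L(a'j+t')` (the factor `L q ^ 2 = 1`). -/
theorem L_pair_zero_class {a a' v c j t t' : ℤ} {q : ℕ} (hq : 1 ≤ q)
    (ht : (q : ℤ) * t = a * v + c) (ht' : (q : ℤ) * t' = a' * v + c)
    (hpos : 0 ≤ a * j + t) (hpos' : 0 ≤ a' * j + t') :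
    L (a * (v + q * j) + c) * L (a' * (v + q * j) + c) = L (a * j + t) * L (a' * j + t') := by
  rw [L_entry_zero_class ht hpos, L_entry_zero_class ht' hpos']
  have hq1 : L q * L q = 1 := L_mul_self_of_pos (by exact_mod_cast hq)
  linear_combination (L (a * j + t) * L (a' * j + t')) * hq1

/-- The crux restricted to class selectors that pick ZERO classes (`q ∣ u_q v_q + c` for every
dilation) — the part of `DilatedTableChowla` that the route's glue `SieveToMAvg` (iii) consumes
(there `v = h u⁻¹`, `c = −h`). By (N1)–(N4) each of its blocks is a row-shifted multiplication
table of `λ` itself at scale `x/q` with bounded aligned shifts and determinant `hkc`. -/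
def ZeroClassDilated : Prop :=
  ∀ c : ℤ, c ≠ 0 → ∀ δ : ℝ, 0 < δ → δ ≤ 1 / 12 → ∀ C : ℝ, 0 < C → ∃ x₀ : ℝ, ∀ x : ℝ, x₀ ≤ x →
    ∀ A : ℝ, x ^ δ ≤ A → A ≤ x ^ (1 / 3 + δ) → ∀ u v : ℕ → ℕ,
      (∀ q : ℕ, 1 ≤ q → (q : ℤ) ∣ (u q : ℤ) * (v q : ℤ) + c) →
        lhs c δ x A u v ≤ x ^ 2 / Real.log x ^ C

/-- The crux restricted to selectors that pick NON-zero classes at every dilation `q ≥ 2`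
(`q = 1` is always a zero class: its term is the plain table of `TableChowla`).  By (N1') each of
its blocks at `q` is a row-shifted table of a `q₁`-DILATED symbol `λ(q₁ m + t)`, `1 < q₁ ∣ q`,
`(t, q₁) = 1`: two-point content = Chowla for `λ` INSIDE a unit class mod `q₁` (the shape of
`Literature.Barriers.Parity.Polymath2014_liouvillePairAP`), not consumed by the glue. -/
def NonzeroClassDilated : Prop :=
  ∀ c : ℤ, c ≠ 0 → ∀ δ : ℝ, 0 < δ → δ ≤ 1 / 12 → ∀ C : ℝ, 0 < C → ∃ x₀ : ℝ, ∀ x : ℝ, x₀ ≤ x →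
    ∀ A : ℝ, x ^ δ ≤ A → A ≤ x ^ (1 / 3 + δ) → ∀ u v : ℕ → ℕ,
      (∀ q : ℕ, 2 ≤ q → ¬ (q : ℤ) ∣ (u q : ℤ) * (v q : ℤ) + c) →
        lhs c δ x A u v ≤ x ^ 2 / Real.log x ^ C

/-- Trivial direction: the crux contains both halves. -/
theorem halves_of_crux (h : DilatedTableChowla) : ZeroClassDilated ∧ NonzeroClassDilated := by
  refine ⟨?_, ?_⟩
  · intro c hc δ hδ hδ' C hC
    obtain ⟨x₀, hx₀⟩ := (crux_iff_lhs.1 h) c hc δ hδ hδ' C hC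
    exact ⟨x₀, fun x hx A hA hA' u v _ => hx₀ x hx A hA hA' u v⟩
  · intro c hc δ hδ hδ' C hC
    obtain ⟨x₀, hx₀⟩ := (crux_iff_lhs.1 h) c hc δ hδ hδ' C hC
    exact ⟨x₀, fun x hx A hA hA' u v _ => hx₀ x hx A hA hA' u v⟩

/-- The claimed EXACT split (card `dilated-symbol-normal-form`, Transfer): the two halves give the
crux back (split `lhs` by the predicate `q ∣ u_q v_q + c`, re-select a zero class resp. a non-zero
class on the complementary dilations — both exist for every `q ≥ 2` — use positivity of the terms,
each half at exponent `C+1`, and `2 x²/(log x)^{C+1} ≤ x²/(log x)^C`).  Stated here; the proof is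
crux-plan bookkeeping of the kind of Disproof §10. -/
def NormalFormSplit : Prop := ZeroClassDilated → NonzeroClassDilated → DilatedTableChowla

/-! ## §2 `cm-dichotomy-sections` — the statements of the line -/

/-- A class section `(q;u,v)` is NEAR-EXTREMAL at exponent `C` when some `ℓ²`-unit pair supported
on its rows/columns has bilinear form `≥ √x/(q (log x)^C)` — large RELATIVE TO THE BLOCK
(trivial bound `√x/q`), not relative to the full table. -/
def NearExtremalSection (c : ℤ) (x A : ℝ) (q u v : ℕ) (C : ℝ) : Prop :=
  ∃ α β : ℕ → ℝ, (∑ a ∈ rows A q u, α a ^ 2) = 1 ∧ (∑ b ∈ cols x A q v, β b ^ 2) = 1 ∧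
    Real.sqrt x / (q * Real.log x ^ C) ≤
      |∑ a ∈ rows A q u, ∑ b ∈ cols x A q v, α a * β b * L ((a : ℤ) * b + c)|

/-- A completely multiplicative `1`-bounded COLUMN weight `g` whose image under the section has
near-trivial mean square over the section's rows (`(A/q)·(x/(Aq))²` is the trivial size). -/
def CMWitness (c : ℤ) (x A : ℝ) (q u v : ℕ) (C' : ℝ) : Prop :=
  ∃ g : ℕ → ℂ, g 1 = 1 ∧ (∀ m n : ℕ, g (m * n) = g m * g n) ∧ (∀ n, ‖g n‖ ≤ 1) ∧
    ∃ y : ℝ, 0 ≤ y ∧ y ≤ x / A ∧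
      (A / q) * (x / (A * q)) ^ 2 / Real.log x ^ C' ≤
        ∑ a ∈ rows A q u, ‖∑ b ∈ (cols x A q v).filter (fun b : ℕ => (b : ℝ) ≤ y),
          g b * (L ((a : ℤ) * b + c) : ℂ)‖ ^ 2

/-- (I) INVERSE THEOREM FOR AP-INDEXED HELSON SECTIONS (the lever; research): off a prover-chosen
harmonically sparse set of dilations, every near-extremal class section has a CM column witness.
Crux-implied (vacuously, via `crux_imp_pointwise_markov`: off such a set nothing is near-extremal),
hence exactly as safe as the crux. -/
def InverseCMSections : Prop :=
  ∀ c : ℤ, c ≠ 0 → ∀ δ : ℝ, 0 < δ → δ ≤ 1 / 12 → ∀ C : ℝ, 0 < C → ∃ C' x₀ : ℝ, ∀ x : ℝ, x₀ ≤ x →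
    ∀ A : ℝ, x ^ δ ≤ A → A ≤ x ^ (1 / 3 + δ) → ∀ u v : ℕ → ℕ,
      ∃ E : Finset ℕ, (∑ q ∈ E, (1 : ℝ) / q) ≤ (Real.log x ^ C)⁻¹ ∧
        ∀ q ∈ Finset.Icc 1 ⌊x ^ (δ / 2)⌋₊, q ∉ E →
          NearExtremalSection c x A q (u q) (v q) C → CMWitness c x A q (u q) (v q) C'

/-- (R) RELATIVE-ERROR one-point data at the dilation `q` (what a section's prover can actually
use): `λ` is equidistributed in EVERY class to EVERY modulus `q m`, `m ≤ (log x)^κ`, with error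
`(y/(q m))·(log x)^{-B}` RELATIVE to the class — strictly stronger than absolute character-sum
bounds `|Σ λχ| ≤ y/(log x)^B` (skeleton positivity-quarantine's `OnePointData`), which give only
`y/(log x)^B` per class and are vacuous for `q > (log x)^B`.  Source of truth for generic `q`:
Linnik box with POWER height `T ≍ q (log x)^{B+3}` + log-free density (Gallagher summation). -/
def RelativeLinnikData (q : ℕ) (x B κ : ℝ) : Prop :=
  ∀ m : ℕ, 1 ≤ m → (m : ℝ) ≤ Real.log x ^ κ → ∀ r : ℕ, ∀ y : ℝ, x ^ (1 / 2 : ℝ) ≤ y → y ≤ x ^ 2 →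
    |∑ n ∈ (Finset.Icc 1 ⌊y⌋₊).filter (fun n : ℕ => n ≡ r [MOD q * m]),
        (ArithmeticFunction.liouville n : ℝ)| ≤ y / (q * m * Real.log x ^ B)

/-- (T) THIN-FAMILY BOMBIERI–VINOGRADOV at dilation `q` (the periodic residual's engine): `λ` in
progressions to the moduli `a · m`, `m ≤ q (log x)^κ` a multiple of `q`, for `a` in the AP row set
`rows A q u` (only `≍ A/q` moduli of size `≍ A m ≤ x^{11/24+o(1)}`), with a saving RELATIVE to the
thin family's own mass `x/(q m)`.  Plain BV / the plain large sieve are blind to the `1/q` thinness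
(they certify this only when `A q³ (log x)^{O(1)} ≤ x^{1/2}`, i.e. `5δ/2 ≤ 1/6`); the full range
needs a sparse-moduli large sieve (Baier–Zhao, Baker). -/
def ThinFamilyBV (q : ℕ) (x A : ℝ) (u : ℕ) (C κ : ℝ) : Prop :=
  ∀ m : ℕ, q ∣ m → (m : ℝ) ≤ q * Real.log x ^ κ →
    (∑ a ∈ rows A q u, ⨆ r : Fin (a * m + 1), ⨆ y : ↥(Set.Icc (0 : ℝ) (3 * x)),
        |∑ n ∈ (Finset.Icc 1 ⌊(y : ℝ)⌋₊).filter (fun n : ℕ => n ≡ (r : ℕ) [MOD a * m]),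
          (ArithmeticFunction.liouville n : ℝ)|) ≤ x / (q * m * Real.log x ^ C)

/-- `g` is `p`-periodic for some `1 ≤ p ≤ P`. -/
def IsPeriodicUpTo (g : ℕ → ℂ) (P : ℝ) : Prop := ∃ p : ℕ, 1 ≤ p ∧ (p : ℝ) ≤ P ∧ ∀ n, g (n + p) = g n

/-- (P) PERIODIC RESIDUAL at dilation `q`: no periodic CM weight of period `≤ (log x)^K` is a
witness.  Provable from (T) (+ bookkeeping `|Σ_b g λ| ≤ p · max_r |λ along one progression mod a·lcm(q,p)|`). -/
def PeriodicSections (c : ℤ) (x A : ℝ) (q u v : ℕ) (C' K : ℝ) : Prop :=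
  ∀ g : ℕ → ℂ, g 1 = 1 → (∀ m n : ℕ, g (m * n) = g m * g n) → (∀ n, ‖g n‖ ≤ 1) →
    IsPeriodicUpTo g (Real.log x ^ K) → ∀ y : ℝ, 0 ≤ y → y ≤ x / A →
      (∑ a ∈ rows A q u, ‖∑ b ∈ (cols x A q v).filter (fun b : ℕ => (b : ℝ) ≤ y),
          g b * (L ((a : ℤ) * b + c) : ℂ)‖ ^ 2) < (A / q) * (x / (A * q)) ^ 2 / Real.log x ^ C'

/-- (A) APERIODIC RESIDUAL at dilation `q` (one-sided two-point statement; open, binary-Elliott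
shaped): no aperiodic CM weight is a witness. -/
def AperiodicSections (c : ℤ) (x A : ℝ) (q u v : ℕ) (C' K : ℝ) : Prop :=
  ∀ g : ℕ → ℂ, g 1 = 1 → (∀ m n : ℕ, g (m * n) = g m * g n) → (∀ n, ‖g n‖ ≤ 1) →
    ¬ IsPeriodicUpTo g (Real.log x ^ K) → ∀ y : ℝ, 0 ≤ y → y ≤ x / A →
      (∑ a ∈ rows A q u, ‖∑ b ∈ (cols x A q v).filter (fun b : ℕ => (b : ℝ) ≤ y),
          g b * (L ((a : ℤ) * b + c) : ℂ)‖ ^ 2) < (A / q) * (x / (A * q)) ^ 2 / Real.log x ^ C'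

/-- The dichotomy closes a section: if every CM weight fails to be a witness, an inverse theorem
leaves no near-extremal pair (pure logic, proved). -/
theorem not_nearExtremal_of_residuals {c : ℤ} {x A : ℝ} {q u v : ℕ} {C C' K : ℝ}
    (hI : NearExtremalSection c x A q u v C → CMWitness c x A q u v C')
    (hP : PeriodicSections c x A q u v C' K) (hA : AperiodicSections c x A q u v C' K) :
    ¬ NearExtremalSection c x A q u v C := by
  intro hN
  obtain ⟨g, hg1, hgm, hgb, y, hy0, hyx, hbig⟩ := hI hN
  by_cases hp : IsPeriodicUpTo g (Real.log x ^ K)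
  · exact absurd hbig (not_le.2 (hP g hg1 hgm hgb hp y hy0 hyx))
  · exact absurd hbig (not_le.2 (hA g hg1 hgm hgb hp y hy0 hyx))

/-- CARD-TWO ASSEMBLY (stated; crux-plan proves it from `not_nearExtremal_of_residuals`, the
operator-norm/fourth-moment comparison `q⁴ F ≤ ‖section‖²_op · #rows·#cols`, Disproof §10
`crux_of_pointwiseOffExceptional`, and the quarantine of non-generic `q` exactly as in skeleton
`positivity-quarantine`): generic-`q` relative one-point data ⇒ thin-family BV ⇒ periodic
residual; inverse theorem + both residuals ⇒ pointwise block bound off a sparse set ⇒ crux. -/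
def CardTwoAssembly : Prop :=
  InverseCMSections →
  (∀ c : ℤ, c ≠ 0 → ∀ δ : ℝ, 0 < δ → δ ≤ 1 / 12 → ∀ C' K : ℝ, ∃ x₀ : ℝ, ∀ x : ℝ, x₀ ≤ x →
    ∀ A : ℝ, x ^ δ ≤ A → A ≤ x ^ (1 / 3 + δ) → ∀ u v : ℕ → ℕ,
      ∃ E : Finset ℕ, (∑ q ∈ E, (1 : ℝ) / q) ≤ (Real.log x ^ C')⁻¹ ∧
        ∀ q ∈ Finset.Icc 1 ⌊x ^ (δ / 2)⌋₊, q ∉ E →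
          PeriodicSections c x A q (u q) (v q) C' K ∧ AperiodicSections c x A q (u q) (v q) C' K) →
  DilatedTableChowla

end Summit.Parity.GeneralizedHardyLittlewood.Cruxes.DilatedTableChowla.SketchIdeator4
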